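import Mathlib
import Summits.PneNP.PneNP.Theorems.CnfIdealGenLengthRankDefectRepresentationsTwoFamilyCutDomination
import Summits.PneNP.PneNP.Theorems.CnfIdealGenLengthRankDefectRepresentationsAnchorExtrapolation
import Summits.PneNP.PneNP.Theorems.CnfIdealGenLengthRankDefectRepresentationsStripCompletion
import Summits.PneNP.PneNP.Theorems.CnfIdealGenLengthRankDefectRepresentationsAnchorStrips

/-!
# Crux `RankDefectRepresentations` (stmt-PneNP-18923), line `rank-dehn-ladder`: REDUCTION OF THE LINEAR 2D MAX-CUT DECOMPOSITION TO
# "DOUBLY-FEW CORES" (lead g11, memo `Lines/rank-dehn-ladder-g11.md` §§5, 8, 9)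

The registered stub `stub_doubleMaxCutDecomposition` asks for `D = S_I + S_J + L` with `rank L ≤ λ·c` (LINEAR in the double-cut bound `c`);
Theorem A (p678858) gives the class-independent but quadratic `c + 160c²`.  This file proves that linearity follows from linearity on CORES
of `D`: sub-instances whose rows AND columns have I-colours in a set `P₀` of `≤ c` classes and J-colours in a set `Q₀` of `≤ c` classes
(the same grid `P₀ × Q₀` on both sides).

`doubleMaxCut_of_cores`: if all double cuts of `D` are `≤ c` and every core of `D` (grid `P₀ × Q₀`, `#P₀, #Q₀ ≤ c`) agrees at its visible
entries with a matrix of rank `≤ Λ`, then `D = S_I + S_J + L` with `rank L ≤ 100·c + 4·Λ`.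

Proof (the anchor method with the SUB-ANCHOR STRIP LEMMA, p679859).  Take a maximal anchor `(X₀,Y₀)` (`r ≤ c`; label sets `PI, QJ` of its
columns, `PI′, QJ′` of its rows; `PI ∩ PI′ = QJ ∩ QJ′ = ∅`).  Four applications of the strip lemma (as is; with the two colour families
swapped; transposed; both) give rank-`≤ 9r` pieces agreeing with `D` on (J-good rows) × (good columns), (I-good rows) × (good columns),
(good rows) × (J-good columns), (good rows) × (I-good columns).  Four one-family pieces of rank `≤ 8c` (g7's theorem via
`StripCompletion.exists_piece`) agree with `D` on (rows with I-colour `∈ PI`) × (columns with I-colour `∉ PI`), (rows J `∈ QJ`) × (columns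
J `∉ QJ`), (rows I `∉ PI′`) × (columns I `∈ PI′`), (rows J `∉ QJ′`) × (columns J `∈ QJ′`).  A sixteen-cell case analysis shows that every
visible entry not covered by these eight pieces lies in one of the FOUR CORES on the grids `PI × QJ`, `PI × QJ′`, `PI′ × QJ`, `PI′ × QJ′`;
the cells are products of row and column predicates, so the masked pieces keep their ranks (`StripCompletion.rank_mask_le`).
HONEST FRAMING: a conditional reduction; whether cores are linear (CORE-LINEAR) is OPEN; P ≠ NP is not moved; F-N2 is a FRONTIER formal rung.
-/

set_option linter.dupNamespace false -- `Summit.PneNP.PneNP.…`: summit = sub-problem name (D-0017)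

namespace Summit.PneNP.PneNP.Theorems.CnfIdealGenLengthRankDefectRepresentationsCoreReduction

open Matrix
open Summit.PneNP.PneNP.Theorems.CnfIdealGenLengthRankDefectRepresentationsTwoFamilyCutDomination (colourI colourJ maskJ doubleCut)
open Summit.PneNP.PneNP.Theorems.CnfIdealGenLengthRankDefectRepresentationsMergeLowerBound (rank_add_le')
open Summit.PneNP.PneNP.Theorems.CnfIdealGenLengthRankDefectRepresentationsAnchorExtrapolation (exists_maximal_anchor size_le_of_anchor)
open Summit.PneNP.PneNP.Theorems.CnfIdealGenLengthRankDefectRepresentationsStripCompletion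
  (rank_mask_le rank_block_le_doubleCut exists_piece)
open Summit.PneNP.PneNP.Theorems.CnfIdealGenLengthRankDefectRepresentationsAnchorStrips (exists_rowStrips_completion)

variable {K : Type} [Field K] {n n' : ℕ} {ι ι' : Type} [Fintype ι] [Fintype ι'] [DecidableEq ι] [DecidableEq ι']

section Pieces

variable (row : ι → Fin n ⊕ Fin n' → Bool) (col : ι' → Fin n ⊕ Fin n' → Bool) (D : Matrix ι ι' K)

/-- One-family piece: rows with I-colour in `S` against columns with I-colour outside `S` (coloured by the second family). -/
theorem exists_piece_rowsI (S : Finset (Fin n → Bool)) (c : ℕ) (hc : ∀ B B', doubleCut row col B B' D ≤ c) :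
    ∃ L : Matrix ι ι' K, L.rank ≤ 8 * c ∧ ∀ x y, colourJ (row x) ≠ colourJ (col y) →
      L x y = if colourI (row x) ∈ S ∧ colourI (col y) ∉ S then D x y else 0 := by
  classical
  refine exists_piece D (fun x => colourJ (row x)) (fun y => colourJ (col y))
    (fun x => colourI (row x) ∈ S) (fun y => colourI (col y) ∉ S) c fun T => ⟨?_, ?_⟩
  · refine (rank_block_le_doubleCut row col D S T true true _ _ ?_ ?_).trans (hc S T)
    · rintro x ⟨h1, h2⟩; simp [h1, h2]
    · rintro y ⟨h1, h2⟩; simp [h1, h2]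
  · refine (rank_block_le_doubleCut row col D S T true false _ _ ?_ ?_).trans (hc S T)
    · rintro x ⟨h1, h2⟩; simp [h1, h2]
    · rintro y ⟨h1, h2⟩; simp [h1, h2]

/-- One-family piece: rows with I-colour outside `S` against columns with I-colour in `S` (coloured by the second family). -/
theorem exists_piece_colsI (S : Finset (Fin n → Bool)) (c : ℕ) (hc : ∀ B B', doubleCut row col B B' D ≤ c) :
    ∃ L : Matrix ι ι' K, L.rank ≤ 8 * c ∧ ∀ x y, colourJ (row x) ≠ colourJ (col y) →
      L x y = if colourI (row x) ∉ S ∧ colourI (col y) ∈ S then D x y else 0 := by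
  classical
  refine exists_piece D (fun x => colourJ (row x)) (fun y => colourJ (col y))
    (fun x => colourI (row x) ∉ S) (fun y => colourI (col y) ∈ S) c fun T => ⟨?_, ?_⟩
  · refine (rank_block_le_doubleCut row col D S T false true _ _ ?_ ?_).trans (hc S T)
    · rintro x ⟨h1, h2⟩; simp [h1, h2]
    · rintro y ⟨h1, h2⟩; simp [h1, h2]
  · refine (rank_block_le_doubleCut row col D S T false false _ _ ?_ ?_).trans (hc S T)
    · rintro x ⟨h1, h2⟩; simp [h1, h2]
    · rintro y ⟨h1, h2⟩; simp [h1, h2]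

/-- One-family piece: rows with J-colour in `S′` against columns with J-colour outside `S′` (coloured by the first family). -/
theorem exists_piece_rowsJ (S' : Finset (Fin n' → Bool)) (c : ℕ) (hc : ∀ B B', doubleCut row col B B' D ≤ c) :
    ∃ L : Matrix ι ι' K, L.rank ≤ 8 * c ∧ ∀ x y, colourI (row x) ≠ colourI (col y) →
      L x y = if colourJ (row x) ∈ S' ∧ colourJ (col y) ∉ S' then D x y else 0 := by
  classical
  refine exists_piece D (fun x => colourI (row x)) (fun y => colourI (col y))
    (fun x => colourJ (row x) ∈ S') (fun y => colourJ (col y) ∉ S') c fun B => ⟨?_, ?_⟩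
  · refine (rank_block_le_doubleCut row col D B S' true true _ _ ?_ ?_).trans (hc B S')
    · rintro x ⟨h1, h2⟩; simp [h1, h2]
    · rintro y ⟨h1, h2⟩; simp [h1, h2]
  · refine (rank_block_le_doubleCut row col D B S' false true _ _ ?_ ?_).trans (hc B S')
    · rintro x ⟨h1, h2⟩; simp [h1, h2]
    · rintro y ⟨h1, h2⟩; simp [h1, h2]

/-- One-family piece: rows with J-colour outside `S′` against columns with J-colour in `S′` (coloured by the first family). -/
theorem exists_piece_colsJ (S' : Finset (Fin n' → Bool)) (c : ℕ) (hc : ∀ B B', doubleCut row col B B' D ≤ c) :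
    ∃ L : Matrix ι ι' K, L.rank ≤ 8 * c ∧ ∀ x y, colourI (row x) ≠ colourI (col y) →
      L x y = if colourJ (row x) ∉ S' ∧ colourJ (col y) ∈ S' then D x y else 0 := by
  classical
  refine exists_piece D (fun x => colourI (row x)) (fun y => colourI (col y))
    (fun x => colourJ (row x) ∉ S') (fun y => colourJ (col y) ∈ S') c fun B => ⟨?_, ?_⟩
  · refine (rank_block_le_doubleCut row col D B S' true false _ _ ?_ ?_).trans (hc B S')
    · rintro x ⟨h1, h2⟩; simp [h1, h2]
    · rintro y ⟨h1, h2⟩; simp [h1, h2]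
  · refine (rank_block_le_doubleCut row col D B S' false false _ _ ?_ ?_).trans (hc B S')
    · rintro x ⟨h1, h2⟩; simp [h1, h2]
    · rintro y ⟨h1, h2⟩; simp [h1, h2]

end Pieces

section StripVariants

variable (row : ι → Fin n ⊕ Fin n' → Bool) (col : ι' → Fin n ⊕ Fin n' → Bool) (D : Matrix ι ι' K)

/-- Strip lemma, second variant (the two colour families exchanged): (I-good rows) × (good columns). -/
theorem exists_rowStripsI_completion {r : ℕ} (X₀ : Fin r → ι) (Y₀ : Fin r → ι')
    (hco : ∀ i j, colourI (row (X₀ i)) ≠ colourI (col (Y₀ j)) ∧ colourJ (row (X₀ i)) ≠ colourJ (col (Y₀ j)))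
    (hu : IsUnit (D.submatrix X₀ Y₀).det)
    (hmax : ∀ (X' : Fin (r + 1) → ι) (Y' : Fin (r + 1) → ι'),
      (∀ i j, colourI (row (X' i)) ≠ colourI (col (Y' j)) ∧ colourJ (row (X' i)) ≠ colourJ (col (Y' j))) →
      ¬ IsUnit (D.submatrix X' Y').det) :
    ∃ L : Matrix ι ι' K, L.rank ≤ 9 * r ∧
      ∀ x y, colourI (row x) ≠ colourI (col y) → colourJ (row x) ≠ colourJ (col y) →
        colourI (row x) ∉ Finset.univ.image (fun j => colourI (col (Y₀ j))) →
        colourI (col y) ∉ Finset.univ.image (fun i => colourI (row (X₀ i))) →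
        colourJ (col y) ∉ Finset.univ.image (fun i => colourJ (row (X₀ i))) →
        L x y = D x y := by
  obtain ⟨L, hL, hagree⟩ := exists_rowStrips_completion (n := n') (n' := n)
    (fun x => (row x) ∘ Sum.swap) (fun y => (col y) ∘ Sum.swap) D X₀ Y₀
    (fun i j => ⟨(hco i j).2, (hco i j).1⟩) hu
    (fun X' Y' h => hmax X' Y' fun i j => ⟨(h i j).2, (h i j).1⟩)
  exact ⟨L, hL, fun x y hI hJ h1 h2 h3 => hagree x y hJ hI h1 h3 h2⟩

/-- Strip lemma, third variant (transposed): (good rows) × (J-good columns). -/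
theorem exists_colStrips_completion {r : ℕ} (X₀ : Fin r → ι) (Y₀ : Fin r → ι')
    (hco : ∀ i j, colourI (row (X₀ i)) ≠ colourI (col (Y₀ j)) ∧ colourJ (row (X₀ i)) ≠ colourJ (col (Y₀ j)))
    (hu : IsUnit (D.submatrix X₀ Y₀).det)
    (hmax : ∀ (X' : Fin (r + 1) → ι) (Y' : Fin (r + 1) → ι'),
      (∀ i j, colourI (row (X' i)) ≠ colourI (col (Y' j)) ∧ colourJ (row (X' i)) ≠ colourJ (col (Y' j))) →
      ¬ IsUnit (D.submatrix X' Y').det) :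
    ∃ L : Matrix ι ι' K, L.rank ≤ 9 * r ∧
      ∀ x y, colourI (row x) ≠ colourI (col y) → colourJ (row x) ≠ colourJ (col y) →
        colourI (row x) ∉ Finset.univ.image (fun j => colourI (col (Y₀ j))) →
        colourJ (row x) ∉ Finset.univ.image (fun j => colourJ (col (Y₀ j))) →
        colourJ (col y) ∉ Finset.univ.image (fun i => colourJ (row (X₀ i))) →
        L x y = D x y := by
  have hu' : IsUnit (Dᵀ.submatrix Y₀ X₀).det := by
    rw [show Dᵀ.submatrix Y₀ X₀ = (D.submatrix X₀ Y₀)ᵀ from (Matrix.transpose_submatrix _ _ _).symm, Matrix.det_transpose]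
    exact hu
  have hmax' : ∀ (Y' : Fin (r + 1) → ι') (X' : Fin (r + 1) → ι),
      (∀ i j, colourI (col (Y' i)) ≠ colourI (row (X' j)) ∧ colourJ (col (Y' i)) ≠ colourJ (row (X' j))) →
      ¬ IsUnit (Dᵀ.submatrix Y' X').det := by
    intro Y' X' h hu2
    refine hmax X' Y' (fun i j => ⟨(h j i).1.symm, (h j i).2.symm⟩) ?_
    rw [show D.submatrix X' Y' = (Dᵀ.submatrix Y' X')ᵀ from (Matrix.transpose_submatrix _ _ _).symm, Matrix.det_transpose]
    exact hu2
  obtain ⟨L, hL, hagree⟩ := exists_rowStrips_completion col row Dᵀ Y₀ X₀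
    (fun i j => ⟨(hco j i).1.symm, (hco j i).2.symm⟩) hu' hmax'
  refine ⟨Lᵀ, by rw [Matrix.rank_transpose]; exact hL, fun x y hI hJ h1 h2 h3 => ?_⟩
  rw [Matrix.transpose_apply]
  exact hagree y x hI.symm hJ.symm h3 h1 h2

/-- Strip lemma, fourth variant (transposed, families exchanged): (good rows) × (I-good columns). -/
theorem exists_colStripsI_completion {r : ℕ} (X₀ : Fin r → ι) (Y₀ : Fin r → ι')
    (hco : ∀ i j, colourI (row (X₀ i)) ≠ colourI (col (Y₀ j)) ∧ colourJ (row (X₀ i)) ≠ colourJ (col (Y₀ j)))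
    (hu : IsUnit (D.submatrix X₀ Y₀).det)
    (hmax : ∀ (X' : Fin (r + 1) → ι) (Y' : Fin (r + 1) → ι'),
      (∀ i j, colourI (row (X' i)) ≠ colourI (col (Y' j)) ∧ colourJ (row (X' i)) ≠ colourJ (col (Y' j))) →
      ¬ IsUnit (D.submatrix X' Y').det) :
    ∃ L : Matrix ι ι' K, L.rank ≤ 9 * r ∧
      ∀ x y, colourI (row x) ≠ colourI (col y) → colourJ (row x) ≠ colourJ (col y) →
        colourI (row x) ∉ Finset.univ.image (fun j => colourI (col (Y₀ j))) →
        colourJ (row x) ∉ Finset.univ.image (fun j => colourJ (col (Y₀ j))) →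
        colourI (col y) ∉ Finset.univ.image (fun i => colourI (row (X₀ i))) →
        L x y = D x y := by
  obtain ⟨L, hL, hagree⟩ := exists_colStrips_completion (n := n') (n' := n)
    (fun x => (row x) ∘ Sum.swap) (fun y => (col y) ∘ Sum.swap) D X₀ Y₀
    (fun i j => ⟨(hco i j).2, (hco i j).1⟩) hu
    (fun X' Y' h => hmax X' Y' fun i j => ⟨(h i j).2, (h i j).1⟩)
  exact ⟨L, hL, fun x y hI hJ h1 h2 h3 => hagree x y hJ hI h2 h1 h3⟩

end StripVariants

/-- **REDUCTION TO CORES.**  If all double bipartition cuts of `D` are `≤ c`, and for every grid `P₀ × Q₀` of at most `c` first-family and at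
most `c` second-family colour classes the CORE of `D` on that grid (rows and columns whose colour pairs lie in `P₀ × Q₀`) agrees at its
visible entries with a matrix of rank `≤ Λ`, then `D = S_I + S_J + L` with `rank L ≤ 100·c + 4·Λ`. -/
theorem doubleMaxCut_of_cores (K : Type) [Field K] (n n' : ℕ) (ι ι' : Type) [Fintype ι] [Fintype ι']
    [DecidableEq ι] [DecidableEq ι']
    (row : ι → Fin n ⊕ Fin n' → Bool) (col : ι' → Fin n ⊕ Fin n' → Bool) (D : Matrix ι ι' K) (c Λ : ℕ)
    (hc : ∀ B B', doubleCut row col B B' D ≤ c)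
    (hcore : ∀ (P₀ : Finset (Fin n → Bool)) (Q₀ : Finset (Fin n' → Bool)), P₀.card ≤ c → Q₀.card ≤ c →
      ∃ L : Matrix ι ι' K, L.rank ≤ Λ ∧ ∀ x y, colourI (row x) ≠ colourI (col y) → colourJ (row x) ≠ colourJ (col y) →
        colourI (row x) ∈ P₀ → colourJ (row x) ∈ Q₀ → colourI (col y) ∈ P₀ → colourJ (col y) ∈ Q₀ → L x y = D x y) :
    ∃ SI SJ : Matrix ι ι' K,
      (∀ x y, (∃ k, row x (Sum.inl k) ≠ col y (Sum.inl k)) → SI x y = 0) ∧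
      (∀ x y, (∃ k', row x (Sum.inr k') ≠ col y (Sum.inr k')) → SJ x y = 0) ∧
      (D - SI - SJ).rank ≤ 100 * c + 4 * Λ := by
  classical
  -- the maximal anchor and its label sets
  obtain ⟨r, X₀, Y₀, hco, hu, hmax⟩ := exists_maximal_anchor row col D
  have hrc : r ≤ c := size_le_of_anchor row col D hco hu hc
  let cIr : ι → (Fin n → Bool) := fun x => colourI (row x)
  let cJr : ι → (Fin n' → Bool) := fun x => colourJ (row x)
  let cIc : ι' → (Fin n → Bool) := fun y => colourI (col y)
  let cJc : ι' → (Fin n' → Bool) := fun y => colourJ (col y)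
  set PI : Finset (Fin n → Bool) := Finset.univ.image (fun j => colourI (col (Y₀ j))) with hPI
  set QJ : Finset (Fin n' → Bool) := Finset.univ.image (fun j => colourJ (col (Y₀ j))) with hQJ
  set PI' : Finset (Fin n → Bool) := Finset.univ.image (fun i => colourI (row (X₀ i))) with hPI'
  set QJ' : Finset (Fin n' → Bool) := Finset.univ.image (fun i => colourJ (row (X₀ i))) with hQJ'
  have hcard : ∀ {α : Type} [DecidableEq α] (f : Fin r → α), (Finset.univ.image f).card ≤ c := by
    intro α _ f
    exact Finset.card_image_le.trans (by rw [Finset.card_univ, Fintype.card_fin]; exact hrc)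
  -- the anchor's row labels and column labels are disjoint
  have hPdisj : ∀ p, p ∈ PI → p ∉ PI' := by
    intro p h1 h2
    obtain ⟨j, -, hj⟩ := Finset.mem_image.1 h1
    obtain ⟨i, -, hi⟩ := Finset.mem_image.1 h2
    exact (hco i j).1 (hi.trans hj.symm)
  have hQdisj : ∀ q, q ∈ QJ → q ∉ QJ' := by
    intro q h1 h2
    obtain ⟨j, -, hj⟩ := Finset.mem_image.1 h1
    obtain ⟨i, -, hi⟩ := Finset.mem_image.1 h2
    exact (hco i j).2 (hi.trans hj.symm)
  -- the eight pieces and the four cores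
  obtain ⟨L1, hL1, hL1a⟩ := exists_rowStrips_completion row col D X₀ Y₀ hco hu hmax
  obtain ⟨L2, hL2, hL2a⟩ := exists_rowStripsI_completion row col D X₀ Y₀ hco hu hmax
  obtain ⟨L3, hL3, hL3a⟩ := exists_colStrips_completion row col D X₀ Y₀ hco hu hmax
  obtain ⟨L4, hL4, hL4a⟩ := exists_colStripsI_completion row col D X₀ Y₀ hco hu hmax
  obtain ⟨A, hA, hAa⟩ := exists_piece_rowsI row col D PI c hc
  obtain ⟨B, hB, hBa⟩ := exists_piece_rowsJ row col D QJ c hc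
  obtain ⟨C, hC, hCa⟩ := exists_piece_colsI row col D PI' c hc
  obtain ⟨D4, hD4, hD4a⟩ := exists_piece_colsJ row col D QJ' c hc
  obtain ⟨K1, hK1, hK1a⟩ := hcore PI QJ' (hcard _) (hcard _)
  obtain ⟨K2, hK2, hK2a⟩ := hcore PI' QJ (hcard _) (hcard _)
  obtain ⟨K3, hK3, hK3a⟩ := hcore PI QJ (hcard _) (hcard _)
  obtain ⟨K4, hK4, hK4a⟩ := hcore PI' QJ' (hcard _) (hcard _)
  -- row classes
  let ra : ι → Prop := fun x => cIr x ∈ PI ∧ cJr x ∈ QJ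
  let rb : ι → Prop := fun x => cIr x ∈ PI ∧ cJr x ∉ QJ
  let rc : ι → Prop := fun x => cIr x ∉ PI ∧ cJr x ∈ QJ
  let rd : ι → Prop := fun x => cIr x ∉ PI ∧ cJr x ∉ QJ
  -- the sixteen cells
  let cell : (ι → Prop) → (ι' → Prop) → Matrix ι ι' K → Matrix ι ι' K :=
    fun P Q M => Matrix.of fun x y => if P x ∧ Q y then M x y else 0
  have hcell : ∀ (P : ι → Prop) (Q : ι' → Prop) (M : Matrix ι ι' K), (cell P Q M).rank ≤ M.rank := by
    intro P Q M
    exact rank_mask_le P Q M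
  set Lsum : Matrix ι ι' K :=
    cell ra (fun y => cIc y ∉ PI) A +
    cell ra (fun y => cIc y ∈ PI ∧ cJc y ∉ QJ) B +
    cell ra (fun y => cIc y ∈ PI ∧ cJc y ∈ QJ) K3 +
    cell rb (fun y => cIc y ∉ PI) A +
    cell rb (fun y => cIc y ∈ PI ∧ cJc y ∉ QJ') L1 +
    cell (fun x => rb x ∧ cJr x ∉ QJ') (fun y => cIc y ∈ PI ∧ cJc y ∈ QJ') D4 +
    cell (fun x => rb x ∧ cJr x ∈ QJ') (fun y => cIc y ∈ PI ∧ cJc y ∈ QJ') K1 +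
    cell rc (fun y => cJc y ∉ QJ) B +
    cell rc (fun y => cJc y ∈ QJ ∧ cIc y ∉ PI') L2 +
    cell (fun x => rc x ∧ cIr x ∉ PI') (fun y => cJc y ∈ QJ ∧ cIc y ∈ PI') C +
    cell (fun x => rc x ∧ cIr x ∈ PI') (fun y => cJc y ∈ QJ ∧ cIc y ∈ PI') K2 +
    cell rd (fun y => cJc y ∉ QJ') L3 +
    cell rd (fun y => cJc y ∈ QJ' ∧ cIc y ∉ PI') L4 +
    cell (fun x => rd x ∧ cIr x ∉ PI') (fun y => cJc y ∈ QJ' ∧ cIc y ∈ PI') C +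
    cell (fun x => rd x ∧ cIr x ∈ PI' ∧ cJr x ∉ QJ') (fun y => cJc y ∈ QJ' ∧ cIc y ∈ PI') D4 +
    cell (fun x => rd x ∧ cIr x ∈ PI' ∧ cJr x ∈ QJ') (fun y => cJc y ∈ QJ' ∧ cIc y ∈ PI') K4 with hLsum
  have hLrank : Lsum.rank ≤ 100 * c + 4 * Λ := by
    have hadd : ∀ (X Y : Matrix ι ι' K) (a b : ℕ), X.rank ≤ a → Y.rank ≤ b → (X + Y).rank ≤ a + b :=
      fun X Y a b hX hY => (rank_add_le' X Y).trans (Nat.add_le_add hX hY)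
    have e := fun (P : ι → Prop) (Q : ι' → Prop) (M : Matrix ι ι' K) => hcell P Q M
    have a1 := (e ra (fun y => cIc y ∉ PI) A).trans hA
    have a2 := (e ra (fun y => cIc y ∈ PI ∧ cJc y ∉ QJ) B).trans hB
    have a3 := (e ra (fun y => cIc y ∈ PI ∧ cJc y ∈ QJ) K3).trans hK3
    have b1 := (e rb (fun y => cIc y ∉ PI) A).trans hA
    have b2 := (e rb (fun y => cIc y ∈ PI ∧ cJc y ∉ QJ') L1).trans hL1
    have b3 := (e (fun x => rb x ∧ cJr x ∉ QJ') (fun y => cIc y ∈ PI ∧ cJc y ∈ QJ') D4).trans hD4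
    have b4 := (e (fun x => rb x ∧ cJr x ∈ QJ') (fun y => cIc y ∈ PI ∧ cJc y ∈ QJ') K1).trans hK1
    have c1 := (e rc (fun y => cJc y ∉ QJ) B).trans hB
    have c2 := (e rc (fun y => cJc y ∈ QJ ∧ cIc y ∉ PI') L2).trans hL2
    have c3 := (e (fun x => rc x ∧ cIr x ∉ PI') (fun y => cJc y ∈ QJ ∧ cIc y ∈ PI') C).trans hC
    have c4 := (e (fun x => rc x ∧ cIr x ∈ PI') (fun y => cJc y ∈ QJ ∧ cIc y ∈ PI') K2).trans hK2
    have d1 := (e rd (fun y => cJc y ∉ QJ') L3).trans hL3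
    have d2 := (e rd (fun y => cJc y ∈ QJ' ∧ cIc y ∉ PI') L4).trans hL4
    have d3 := (e (fun x => rd x ∧ cIr x ∉ PI') (fun y => cJc y ∈ QJ' ∧ cIc y ∈ PI') C).trans hC
    have d4 := (e (fun x => rd x ∧ cIr x ∈ PI' ∧ cJr x ∉ QJ') (fun y => cJc y ∈ QJ' ∧ cIc y ∈ PI') D4).trans hD4
    have d5 := (e (fun x => rd x ∧ cIr x ∈ PI' ∧ cJr x ∈ QJ') (fun y => cJc y ∈ QJ' ∧ cIc y ∈ PI') K4).trans hK4
    rw [hLsum]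
    refine (hadd _ _ _ _ (hadd _ _ _ _ (hadd _ _ _ _ (hadd _ _ _ _ (hadd _ _ _ _ (hadd _ _ _ _ (hadd _ _ _ _ (hadd _ _ _ _
      (hadd _ _ _ _ (hadd _ _ _ _ (hadd _ _ _ _ (hadd _ _ _ _ (hadd _ _ _ _ (hadd _ _ _ _ (hadd _ _ _ _
      a1 a2) a3) b1) b2) b3) b4) c1) c2) c3) c4) d1) d2) d3) d4) d5).trans ?_
    have h9 : 9 * r ≤ 9 * c := Nat.mul_le_mul_left 9 hrc
    omega
  -- the glued matrix agrees with `D` at every visible entry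
  have hLagree : ∀ x y, cIr x ≠ cIc y → cJr x ≠ cJc y → Lsum x y = D x y := by
    intro x y hI hJ
    have eA := hAa x y hJ
    have eB := hBa x y hI
    have eC := hCa x y hJ
    have eD := hD4a x y hI
    simp only [hLsum, cell, Matrix.add_apply, Matrix.of_apply]
    by_cases p1 : colourI (row x) ∈ PI <;> by_cases q1 : colourJ (row x) ∈ QJ
    · -- class a (doubly colliding row)
      by_cases p2 : colourI (col y) ∈ PI
      · by_cases q2 : colourJ (col y) ∈ QJ
        · have e3 := hK3a x y hI hJ p1 q1 p2 q2
          simp [cIr, cJr, cIc, cJc, ra, rb, rc, rd, p1, q1, p2, q2, e3]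
        · simp [cIr, cJr, cIc, cJc, ra, rb, rc, rd, p1, q1, p2, q2, eB]
      · simp [cIr, cJr, cIc, cJc, ra, rb, rc, rd, p1, q1, p2, eA]
    · -- class b (I-colliding, J-good row)
      by_cases p2 : colourI (col y) ∈ PI
      · have p2' : colourI (col y) ∉ PI' := hPdisj _ p2
        by_cases q2 : colourJ (col y) ∈ QJ'
        · by_cases q3 : colourJ (row x) ∈ QJ'
          · have e1 := hK1a x y hI hJ p1 q3 p2 q2
            simp [cIr, cJr, cIc, cJc, ra, rb, rc, rd, p1, q1, p2, q2, q3, e1]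
          · simp [cIr, cJr, cIc, cJc, ra, rb, rc, rd, p1, q1, p2, q2, q3, eD]
        · have e1 := hL1a x y hI hJ q1 p2' q2
          simp [cIr, cJr, cIc, cJc, ra, rb, rc, rd, p1, q1, p2, q2, e1]
      · simp [cIr, cJr, cIc, cJc, ra, rb, rc, rd, p1, q1, p2, eA]
    · -- class c (J-colliding, I-good row)
      by_cases q2 : colourJ (col y) ∈ QJ
      · have q2' : colourJ (col y) ∉ QJ' := hQdisj _ q2
        by_cases p2 : colourI (col y) ∈ PI'
        · by_cases p3 : colourI (row x) ∈ PI'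
          · have e2 := hK2a x y hI hJ p3 q1 p2 q2
            simp [cIr, cJr, cIc, cJc, ra, rb, rc, rd, p1, q1, p2, q2, p3, e2]
          · simp [cIr, cJr, cIc, cJc, ra, rb, rc, rd, p1, q1, p2, q2, p3, eC]
        · have e2 := hL2a x y hI hJ p1 p2 q2'
          simp [cIr, cJr, cIc, cJc, ra, rb, rc, rd, p1, q1, p2, q2, e2]
      · simp [cIr, cJr, cIc, cJc, ra, rb, rc, rd, p1, q1, q2, eB]
    · -- class d (good row)
      by_cases q2 : colourJ (col y) ∈ QJ'
      · by_cases p2 : colourI (col y) ∈ PI'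
        · by_cases p3 : colourI (row x) ∈ PI'
          · by_cases q3 : colourJ (row x) ∈ QJ'
            · have e4 := hK4a x y hI hJ p3 q3 p2 q2
              simp [cIr, cJr, cIc, cJc, ra, rb, rc, rd, p1, q1, p2, q2, p3, q3, e4]
            · simp [cIr, cJr, cIc, cJc, ra, rb, rc, rd, p1, q1, p2, q2, p3, q3, eD]
          · simp [cIr, cJr, cIc, cJc, ra, rb, rc, rd, p1, q1, p2, q2, p3, eC]
        · have e4 := hL4a x y hI hJ p1 q1 p2
          simp [cIr, cJr, cIc, cJc, ra, rb, rc, rd, p1, q1, p2, q2, e4]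
      · have e3 := hL3a x y hI hJ p1 q1 q2
        simp [cIr, cJr, cIc, cJc, ra, rb, rc, rd, p1, q1, q2, e3]
  -- assembly
  set N : Matrix ι ι' K := D - Lsum with hN
  refine ⟨Matrix.of fun x y => if colourI (row x) = colourI (col y) then N x y else 0,
    Matrix.of fun x y => if colourI (row x) ≠ colourI (col y) then N x y else 0, ?_, ?_, ?_⟩
  · intro x y ⟨k, hk⟩
    have h : colourI (row x) ≠ colourI (col y) := fun h => hk (congrFun h k)
    simp [h]
  · intro x y ⟨k, hk⟩
    have hJ : colourJ (row x) ≠ colourJ (col y) := fun h => hk (congrFun h k)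
    by_cases hI : colourI (row x) = colourI (col y)
    · simp [hI]
    · have : N x y = 0 := by
        rw [hN, Matrix.sub_apply, hLagree x y hI hJ, sub_self]
      simp [this]
  · have hdec : D - (Matrix.of fun x y => if colourI (row x) = colourI (col y) then N x y else 0) -
        (Matrix.of fun x y => if colourI (row x) ≠ colourI (col y) then N x y else 0) = Lsum := by
      ext x y
      simp only [hN, Matrix.sub_apply, Matrix.of_apply]
      by_cases h : colourI (row x) = colourI (col y)
      · rw [if_pos h, if_neg (fun hne => hne h)]; ring
      · rw [if_neg h, if_pos h]; ring
    rw [hdec]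
    exact hLrank

end Summit.PneNP.PneNP.Theorems.CnfIdealGenLengthRankDefectRepresentationsCoreReduction
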